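import Summits.AnomalousDissipation.AnomalousDissipation.Theorems.MomentParityResolvedDissipationSmallData
import Summits.AnomalousDissipation.AnomalousDissipation.Theorems.MomentParityResolvedDissipationReduction

/-!
# `MomentParity.ResolvedDissipation` (stmt-AnomalousDissipation-14284), line `enstrophy-ui-transfer`:
# the CRUX'S CONCLUSION holds in the laminar regime `‖f‖₂ ≤ ν²/4`

Supports stmt-AnomalousDissipation-14284 (helper of the line lead; nothing here closes an item).

`resolvedDissipation_smallForce`: `uniformIntegrability_smallForce` (`…SmallData.lean`: the hard stub of the line proved for
`∫‖f‖² ≤ ν⁴/16`) fed into the reduction `resolvedDissipation_of_uniformIntegrability` (`…Reduction.lean`) yields the body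
of `ResolvedDissipation` at every `(f, ν, R)` with `∫‖f‖² ≤ ν⁴/16`, verbatim. The crux asks it for ALL smooth forces;
outside the laminar regime it is open (= the hard stub = mean energy equality of Galerkin-limit stationary statistical
solutions, `Cruxes/ResolvedDissipation/WhyItResists.md`).
-/

noncomputable section

-- `Summit.<Summit>.<Problem>`: single-conjunct summit, the duplicate namespace segment is mandated.
set_option linter.dupNamespace false

namespace Summit.AnomalousDissipation.AnomalousDissipation.Theorems.MomentParityResolvedDissipation

open MeasureTheory Filter Topology
open scoped ENNReal InnerProductSpace RealInnerProductSpace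
open Literature.Analysis.FunctionSpaces Literature.Analysis.FluidPDE
open Summit.AnomalousDissipation.AnomalousDissipation.Theses.MomentParity
open Summit.AnomalousDissipation.AnomalousDissipation.Theorems.CubicParityLoud.Negative (T3 R3 H3 L2T3)
open Summit.AnomalousDissipation.AnomalousDissipation.Theorems.QuarticGate.Negative
  (IsLevel IsBandTest polyGrad IsPolyStationary)

/-- **`ResolvedDissipation` holds in the laminar regime.** For every smooth divergence-free mean-zero force `f`,
every `ν > 0` with `∫‖f‖² ≤ ν⁴/16` and every `R` there is ONE schedule `κ` such that every admissible law at
`(f, ν, R)` (probability, level-`N` carried, supported in `‖u‖ ≤ R`, stationary for Galerkin NS against all polynomial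
cylindrical band-limited observables) is `κ`-resolved at every level `N` — the crux's own conclusion at `(f, ν, R)`,
verbatim: `uniformIntegrability_smallForce` fed into the reduction `resolvedDissipation_of_uniformIntegrability`.
The crux itself asks this for ALL smooth `f`; outside the laminar regime it is open (= the hard stub U). [folklore] -/
theorem resolvedDissipation_smallForce :
    ∀ f : UnitAddTorus (Fin 3) → EuclideanSpace ℝ (Fin 3),
      Torus.IsSmooth f → Torus.IsDivFree f → Torus.HasZeroMean f →
      ∀ ν : ℝ, 0 < ν → ∫ x, ‖f x‖ ^ 2 ≤ ν ^ 4 / 16 → ∀ R : ℝ, ∃ κ : ℕ → ℕ,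
        ∀ (N : ℕ) (μ : Measure (Torus.energySpace (Fin 3))), IsProbabilityMeasure μ →
          (∀ᵐ (u : Torus.energySpace (Fin 3)) ∂μ, (∀ k ∉ (Torus.freqBall N).erase (0 : Fin 3 → ℤ),
            UnitAddTorus.mFourierCoeff (EuclideanSpace.complexify ∘
              (u.1 : UnitAddTorus (Fin 3) → EuclideanSpace ℝ (Fin 3))) k = 0)) →
          (∀ᵐ u ∂μ, ‖u‖ ≤ R) →
          (∀ (m : ℕ) (g : Fin m → UnitAddTorus (Fin 3) → EuclideanSpace ℝ (Fin 3)) (P : MvPolynomial (Fin m) ℝ),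
            (∀ i, (Torus.IsSmooth (g i) ∧ Torus.IsDivFree (g i) ∧ Torus.HasZeroMean (g i) ∧
              (∀ k ∉ (Torus.freqBall N).erase (0 : Fin 3 → ℤ),
                UnitAddTorus.mFourierCoeff (EuclideanSpace.complexify ∘ (g i)) k = 0))) →
            Integrable (fun u => Torus.nsGeneratorPairing ν f u (fun x => ∑ i : Fin m,
              (MvPolynomial.eval (fun j => Torus.pairing u.1 (g j)) (MvPolynomial.pderiv i P)) • g i x)) μ ∧
            ∫ u, Torus.nsGeneratorPairing ν f u (fun x => ∑ i : Fin m,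
              (MvPolynomial.eval (fun j => Torus.pairing u.1 (g j)) (MvPolynomial.pderiv i P)) • g i x) ∂μ = 0) →
          ∀ n : ℕ, ∫⁻ (u : Torus.energySpace (Fin 3)),
              Torus.eGradNormSq (u.1 : UnitAddTorus (Fin 3) → EuclideanSpace ℝ (Fin 3)) ∂μ ≤
            (∫⁻ (u : Torus.energySpace (Fin 3)), Torus.eGradNormSq (Torus.fourierTruncate (κ n)
              (u.1 : UnitAddTorus (Fin 3) → EuclideanSpace ℝ (Fin 3))) ∂μ) + ((n : ENNReal) + 1)⁻¹ := by
  intro f hf _hdiv _hzero ν hν hsmall R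
  obtain ⟨κ, hκ⟩ := resolvedDissipation_of_uniformIntegrability f hf ν hν R
    (uniformIntegrability_smallForce f hf ν hν hsmall R)
  refine ⟨κ, fun N μ hp hl hb hs n => hκ N μ hp hl hb ?_ n⟩
  intro d m g P hg _
  exact hs m g P hg

end Summit.AnomalousDissipation.AnomalousDissipation.Theorems.MomentParityResolvedDissipation

end
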